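import Mathlib
import Literature.MathematicalPhysics.StatisticalMechanics.BarlowStacking
import Literature.Geometry.DiscreteGeometry.TwoShellPatterns
import Summits.AtomisticToContinuum.Crystallization.Theorems.PhononSlackCertificatesNearFieldConvexityStubPnfOfLocalCertificate8
import Summits.AtomisticToContinuum.Crystallization.Theorems.PhononSlackCertificatesNearFieldConvexityStubPairCountOfCrossing
import Summits.AtomisticToContinuum.Crystallization.Theorems.PhononSlackCertificatesNearFieldConvexityStubSelfSiteFloor
import Summits.AtomisticToContinuum.Crystallization.Theorems.PhononSlackCertificatesNearFieldConvexityStubFluxEnvelope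

/-!
# Route `NashClassCertificates`, crux `NashNearField` (stmt-AtomisticToContinuum-16827), line `birth`:
# stub `stub_bsmoothOfFlux` (FLUX ⟹ B″, finite bookkeeping)

Skeleton v8 of the line derives the energy stub B″ (the summed Cauchy–Born coercivity in the smooth regime)
as NEAR+FAR ⟹ LL⅒ ⟹ CBBC ⟹ SITEWISE ⟹ FLUX ⟹ B″.  This file proves the last arrow.

FLUX (the first-order flux lemma in summed min-cut form) says: for the data of B″ — a threshold
`r ∈ (0, 1/10]`, a `1/3`-separated configuration `x`, a set `Ω` of 1/20-good particles, Hägg words and affine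
flatness witnesses `(s_i, G_i, ν_i)` with `ν_i ≤ ν₁` at the radius-8 interior sites of `Ω` — and for EVERY
sub-family `S` of radius-8 interior sites,
`κr²·#(FamFar_r ∩ S) − C_R Σ_S ν_i² ≤ Σ_S (½Σ_{j∈Ω∖i} V − e*) + M·Σ_{i∈S, j∈Ω∖S} |x i − x j|⁻⁶`.

B″ follows by taking `S := int₈Ω`, the whole radius-8 interior: the cut `Ω ∖ S` is the radius-8 collar
`B₈ = {i ∈ Ω : some non-member within 8}`, the cut capacity `Σ_{i∈S, j∈B₈} |x i − x j|⁻⁶` is at most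
`250·3⁶·#B₈` by the landed flux envelope (`stub_fluxEnvelope`), the collar self-site terms missing from `Σ_S`
are at least `−(250/12)·3⁶` each by the landed self-site floor (`stub_selfSiteFloor`), and
`#B₈ ≤ (1 + |C_p|(17/4)⁴)·#∂₄Ω` by the landed collar count (`collar8_card_le`) and pair count at scale `17/4`
(`stub_pairCountOfCrossing`).  Constants: the same `κ, ν₁, C_R`, and
`C = ((250/12)·3⁶ + 250·|M|·3⁶)·(1 + |C_p|(17/4)⁴)`.
-/

noncomputable section

open scoped BigOperators
open Literature.MathematicalPhysics.StatisticalMechanics Literature.Geometry.DiscreteGeometry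

namespace Summit.AtomisticToContinuum.Crystallization.Theorems.NashClassCertificatesNashNearField

open Summit.AtomisticToContinuum.Crystallization.Theorems.PhononSlackNearFieldConvexity

/-- **Stub `stub_bsmoothOfFlux` (FLUX ⟹ B″, bookkeeping, proved).**  Take `S :=` all radius-8 interior sites of
`Ω` in the flux lemma: the cut capacity `Σ_(i∈S, j∈Ω∖S) |x i − x j|⁻⁶` is collar-supported (`≤ 250·3⁶·#B₈` by the
flux envelope), the non-interior self-site terms missing from `Σ_S` are `≥ −(250/12)·3⁶` each (self-site floor)
and collar-many, and `#B₈ ≤ (1 + |C_p|(17/4)⁴)·#∂₄Ω` (`collar8_card_le`, `stub_pairCountOfCrossing`). [folklore] -/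
theorem stub_bsmoothOfFlux :
    (∃ κ : ℝ, 0 < κ ∧ ∃ ν₁ : ℝ, 0 < ν₁ ∧ ∃ CR M : ℝ, ∀ r : ℝ, 0 < r → r ≤ 1 / 10 →
      ∀ (N : ℕ) (x : Fin N → EuclideanSpace ℝ (Fin 3)), (∀ i j : Fin N, i ≠ j → 1 / 3 ≤ dist (x i) (x j)) →
      ∀ Ω : Finset (Fin N), (∀ i ∈ Ω, IsTwoShellGood (1 / 20) (47 / 50) 1 x i) →
      ∀ (sW : Fin N → ℤ → ℤ) (Gw : Fin N → (EuclideanSpace ℝ (Fin 3) →L[ℝ] EuclideanSpace ℝ (Fin 3))) (νw : Fin N → ℝ),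
      (∀ i ∈ Ω, (∀ k : Fin N, dist (x k) (x i) ≤ 8 → k ∈ Ω) → IsHaggSeq (sW i) ∧ 0 ≤ νw i ∧ νw i ≤ ν₁ ∧ ((∀ j : Fin N, dist (x j) (x i) ≤ 3 → ∃ m u v : ℤ, dist (x j - x i) ((Gw i) (barlowPos 1 (Real.sqrt 6 / 3) (sW i) m u v)) ≤ (νw i)) ∧ (∀ m u v : ℤ, ‖(Gw i) (barlowPos 1 (Real.sqrt 6 / 3) (sW i) m u v)‖ ≤ 3 → ∃ j : Fin N, dist (x j - x i) ((Gw i) (barlowPos 1 (Real.sqrt 6 / 3) (sW i) m u v)) ≤ (νw i)) ∧ (∀ p : EuclideanSpace ℝ (Fin 3), 4 / 5 * ‖p‖ ≤ ‖(Gw i) p‖ ∧ ‖(Gw i) p‖ ≤ 6 / 5 * ‖p‖))) →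
        ∀ S : Finset (Fin N), S ⊆ Ω.filter (fun i => (∀ k : Fin N, dist (x k) (x i) ≤ 8 → k ∈ Ω)) →
          κ * r ^ 2 * (Nat.card {i : Fin N // i ∈ S ∧ (∀ (A : EuclideanSpace ℝ (Fin 3) →ₗᵢ[ℝ] EuclideanSpace ℝ (Fin 3)) (a h : ℝ), 47 / 50 ≤ a → a ≤ 1 → 39 / 50 * a ≤ h → h ≤ 17 / 20 * a → ∃ m u v : ℤ, ‖barlowPos 1 (Real.sqrt 6 / 3) (sW i) m u v‖ ≤ 3 ∧ r ≤ dist ((Gw i) (barlowPos 1 (Real.sqrt 6 / 3) (sW i) m u v)) (A (barlowPos a h (sW i) m u v)))} : ℝ) - CR * (∑ i ∈ S, (νw i) ^ 2) ≤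
            (∑ i ∈ S, ((1 / 2 : ℝ) * (∑ j ∈ Ω.erase i, lennardJones (dist (x i) (x j))) - (⨅ Q : PeriodicConfiguration 3, Q.energyPerParticle lennardJones))) +
              M * (∑ i ∈ S, ∑ j ∈ Ω \ S, (dist (x i) (x j))⁻¹ ^ 6)) →
    ∃ κ : ℝ, 0 < κ ∧ ∃ ν₁ : ℝ, 0 < ν₁ ∧ ∃ CR C : ℝ, ∀ r : ℝ, 0 < r → r ≤ 1 / 10 →
      ∀ (N : ℕ) (x : Fin N → EuclideanSpace ℝ (Fin 3)), (∀ i j : Fin N, i ≠ j → 1 / 3 ≤ dist (x i) (x j)) →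
      ∀ Ω : Finset (Fin N), (∀ i ∈ Ω, IsTwoShellGood (1 / 20) (47 / 50) 1 x i) →
      ∀ (sW : Fin N → ℤ → ℤ) (Gw : Fin N → (EuclideanSpace ℝ (Fin 3) →L[ℝ] EuclideanSpace ℝ (Fin 3))) (νw : Fin N → ℝ),
      (∀ i ∈ Ω, (∀ k : Fin N, dist (x k) (x i) ≤ 8 → k ∈ Ω) → IsHaggSeq (sW i) ∧ 0 ≤ νw i ∧ νw i ≤ ν₁ ∧ ((∀ j : Fin N, dist (x j) (x i) ≤ 3 → ∃ m u v : ℤ, dist (x j - x i) ((Gw i) (barlowPos 1 (Real.sqrt 6 / 3) (sW i) m u v)) ≤ (νw i)) ∧ (∀ m u v : ℤ, ‖(Gw i) (barlowPos 1 (Real.sqrt 6 / 3) (sW i) m u v)‖ ≤ 3 → ∃ j : Fin N, dist (x j - x i) ((Gw i) (barlowPos 1 (Real.sqrt 6 / 3) (sW i) m u v)) ≤ (νw i)) ∧ (∀ p : EuclideanSpace ℝ (Fin 3), 4 / 5 * ‖p‖ ≤ ‖(Gw i) p‖ ∧ ‖(Gw i) p‖ ≤ 6 / 5 * ‖p‖)))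 →
        κ * r ^ 2 * (Nat.card {i : Fin N // i ∈ Ω ∧ ((∀ k : Fin N, dist (x k) (x i) ≤ 8 → k ∈ Ω) ∧ (∀ (A : EuclideanSpace ℝ (Fin 3) →ₗᵢ[ℝ] EuclideanSpace ℝ (Fin 3)) (a h : ℝ), 47 / 50 ≤ a → a ≤ 1 → 39 / 50 * a ≤ h → h ≤ 17 / 20 * a → ∃ m u v : ℤ, ‖barlowPos 1 (Real.sqrt 6 / 3) (sW i) m u v‖ ≤ 3 ∧ r ≤ dist ((Gw i) (barlowPos 1 (Real.sqrt 6 / 3) (sW i) m u v)) (A (barlowPos a h (sW i) m u v))))} : ℝ) ≤ (∑ i ∈ Ω, (1 / 2 : ℝ) * (∑ j ∈ Ω.erase i, lennardJones (dist (x i) (x j)))) - (Ω.card : ℝ) * (⨅ Q : PeriodicConfiguration 3, Q.energyPerParticle lennardJones) + CR * (∑ i ∈ Ω.filter (fun i => (∀ k : Fin N, dist (x k) (x i) ≤ 8 → k ∈ Ω)), (νw i) ^ 2) + C * (Nat.card {i : Fin N // i ∈ Ω ∧ ∃ j : Fin N, j ∉ Ω ∧ dist (x j) (x i) ≤ 4}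 : ℝ) := by
  intro hFLUX
  obtain ⟨κ, hκ, ν₁, hν₁, CR, M, hflux⟩ := hFLUX
  have hδ : (0 : ℝ) < 1 / 3 := by norm_num
  obtain ⟨Cp, hCp⟩ := stub_pairCountOfCrossing (1 / 3) hδ
  set K : ℝ := 1 + |Cp| * (17 / 4 : ℝ) ^ 4 with hKdef
  set L : ℝ := 250 / 12 * (1 / 3 : ℝ)⁻¹ ^ 6 with hLdef
  set Φc : ℝ := 250 * |M| * (1 / 3 : ℝ)⁻¹ ^ 6 with hΦcdef
  refine ⟨κ, hκ, ν₁, hν₁, CR, (L + Φc) * K, ?_⟩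
  intro r hr hr10 N x hsep Ω hΩ sW Gw νw hW
  -- radius-8 interior and collar of `Ω` (elaborated before `classical`, as in the statement)
  set I : Finset (Fin N) := Ω.filter (fun i => ∀ k : Fin N, dist (x k) (x i) ≤ 8 → k ∈ Ω) with hIdef
  set B : Finset (Fin N) := Ω.filter (fun i => ∃ j : Fin N, j ∉ Ω ∧ dist (x j) (x i) ≤ 8) with hBdef
  -- the flux lemma on the whole radius-8 interior
  have key := hflux r hr hr10 N x hsep Ω hΩ sW Gw νw hW I (Finset.Subset.refl _)
  classical
  rw [lc_natCard_eq, lc_natCard_eq]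
  rw [lc_natCard_eq] at key
  have hIΩ : I ⊆ Ω := Finset.filter_subset _ _
  have hImem : ∀ i, i ∈ I ↔ i ∈ Ω ∧ (∀ k : Fin N, dist (x k) (x i) ≤ 8 → k ∈ Ω) := fun i => by
    rw [hIdef, Finset.mem_filter]
  have hBmem : ∀ i, i ∈ B ↔ i ∈ Ω ∧ i ∉ I := by
    intro i
    rw [hImem]
    simp only [hBdef, Finset.mem_filter]
    constructor
    · rintro ⟨hi, j, hj, hd⟩
      exact ⟨hi, fun h' => hj (h'.2 j hd)⟩
    · rintro ⟨hi, h'⟩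
      refine ⟨hi, ?_⟩
      by_contra hne
      exact h' ⟨hi, fun j hd => by_contra fun hj => hne ⟨j, hj, hd⟩⟩
  have hsdiff : Ω \ I = B := by
    ext i
    rw [Finset.mem_sdiff, hBmem]
  have hdisj : Disjoint I B := by
    rw [Finset.disjoint_left]
    intro i hiI hiB
    exact ((hBmem i).1 hiB).2 hiI
  -- the cut capacity, by the envelope
  have hcap : M * (∑ i ∈ I, ∑ j ∈ Ω \ I, (dist (x i) (x j))⁻¹ ^ 6) ≤ Φc * (B.card : ℝ) := by
    rw [hsdiff]
    have h3 := stub_fluxEnvelope N x (1 / 3) hδ hsep I B hdisj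
    have h0 : (0 : ℝ) ≤ ∑ i ∈ I, ∑ j ∈ B, (dist (x i) (x j))⁻¹ ^ 6 :=
      Finset.sum_nonneg fun i _ => Finset.sum_nonneg fun j _ => by positivity
    calc M * (∑ i ∈ I, ∑ j ∈ B, (dist (x i) (x j))⁻¹ ^ 6)
        ≤ |M| * (∑ i ∈ I, ∑ j ∈ B, (dist (x i) (x j))⁻¹ ^ 6) := mul_le_mul_of_nonneg_right (le_abs_self M) h0
      _ ≤ |M| * (250 * (1 / 3 : ℝ)⁻¹ ^ 6 * (B.card : ℝ)) := mul_le_mul_of_nonneg_left h3 (abs_nonneg M)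
      _ = Φc * (B.card : ℝ) := by rw [hΦcdef]; ring
  -- split the region into interior and collar
  have hΩsplit : ∀ f : Fin N → ℝ, ∑ i ∈ Ω, f i = ∑ i ∈ I, f i + ∑ i ∈ B, f i := by
    intro f
    rw [← Finset.sum_filter_add_sum_filter_not Ω (fun i => i ∈ I)]
    congr 1
    · congr 1
      ext i
      simp only [Finset.mem_filter]
      exact ⟨fun h => h.2, fun h => ⟨hIΩ h, h⟩⟩
    · congr 1
      ext i
      rw [Finset.mem_filter, hBmem]
  -- collar: the self-site floor
  have hBsum : -L * (B.card : ℝ) ≤ ∑ i ∈ B, ((1 / 2 : ℝ) * (∑ j ∈ Ω.erase i, lennardJones (dist (x i) (x j))) -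
      (⨅ Q : PeriodicConfiguration 3, Q.energyPerParticle lennardJones)) := by
    have h : ∑ _i ∈ B, (-L) ≤ ∑ i ∈ B, ((1 / 2 : ℝ) * (∑ j ∈ Ω.erase i, lennardJones (dist (x i) (x j))) -
        (⨅ Q : PeriodicConfiguration 3, Q.energyPerParticle lennardJones)) :=
      Finset.sum_le_sum fun i _ => stub_selfSiteFloor N x (1 / 3) hδ hsep Ω i
    rwa [Finset.sum_const, nsmul_eq_mul, mul_comm] at h
  -- the far interior set is `I ∩ FamFar`
  have hFS : ((Ω.filter (fun i => (∀ k : Fin N, dist (x k) (x i) ≤ 8 → k ∈ Ω) ∧ (∀ (A : EuclideanSpace ℝ (Fin 3) →ₗᵢ[ℝ] EuclideanSpace ℝ (Fin 3)) (a h : ℝ), 47 / 50 ≤ a → a ≤ 1 → 39 / 50 * a ≤ h → h ≤ 17 / 20 * a → ∃ m u v : ℤ, ‖barlowPos 1 (Real.sqrt 6 / 3) (sW i) m u v‖ ≤ 3 ∧ r ≤ dist ((Gw i) (barlowPos 1 (Real.sqrt 6 / 3) (sW i) m u v)) (A (barlowPos a h (sW i) m u v))))).card : ℝ) =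
      ((I.filter (fun i => (∀ (A : EuclideanSpace ℝ (Fin 3) →ₗᵢ[ℝ] EuclideanSpace ℝ (Fin 3)) (a h : ℝ), 47 / 50 ≤ a → a ≤ 1 → 39 / 50 * a ≤ h → h ≤ 17 / 20 * a → ∃ m u v : ℤ, ‖barlowPos 1 (Real.sqrt 6 / 3) (sW i) m u v‖ ≤ 3 ∧ r ≤ dist ((Gw i) (barlowPos 1 (Real.sqrt 6 / 3) (sW i) m u v)) (A (barlowPos a h (sW i) m u v))))).card : ℝ) := by
    congr 2
    ext i
    simp only [Finset.mem_filter, hImem, and_assoc]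
  -- the collar count: `#B ≤ K · #∂₄Ω`
  have hcol := collar8_card_le x Ω
  have hpair := hCp N x hsep Ω hΩ (17 / 4) (by norm_num)
  rw [lc_natCard_eq] at hpair
  set B4c : ℝ := ((Ω.filter fun i => ∃ j : Fin N, j ∉ Ω ∧ dist (x j) (x i) ≤ 4).card : ℝ) with hB4c
  have hB40 : 0 ≤ B4c := Nat.cast_nonneg _
  have hBle : (B.card : ℝ) ≤ K * B4c := by
    have h1 : (B.card : ℝ) ≤ B4c + Cp * (17 / 4 : ℝ) ^ 4 * B4c := by
      have := hcol
      rw [← hBdef] at this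
      linarith
    have h2 : Cp * (17 / 4 : ℝ) ^ 4 * B4c ≤ |Cp| * (17 / 4 : ℝ) ^ 4 * B4c :=
      mul_le_mul_of_nonneg_right (mul_le_mul_of_nonneg_right (le_abs_self Cp) (by positivity)) hB40
    rw [hKdef]
    nlinarith
  have hRHS : (∑ i ∈ Ω, (1 / 2 : ℝ) * (∑ j ∈ Ω.erase i, lennardJones (dist (x i) (x j)))) -
      (Ω.card : ℝ) * (⨅ Q : PeriodicConfiguration 3, Q.energyPerParticle lennardJones) =
      ∑ i ∈ Ω, ((1 / 2 : ℝ) * (∑ j ∈ Ω.erase i, lennardJones (dist (x i) (x j))) - (⨅ Q : PeriodicConfiguration 3, Q.energyPerParticle lennardJones)) := by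
    rw [Finset.sum_sub_distrib, Finset.sum_const, nsmul_eq_mul]
  rw [hFS, hRHS, hΩsplit]
  have hB0 : (0 : ℝ) ≤ (B.card : ℝ) := Nat.cast_nonneg _
  have hL0 : 0 ≤ L := by rw [hLdef]; positivity
  have hΦ0 : 0 ≤ Φc := by rw [hΦcdef]; positivity
  have hcoef : 0 ≤ L + Φc := by positivity
  have hstep : (L + Φc) * (B.card : ℝ) ≤ (L + Φc) * (K * B4c) := mul_le_mul_of_nonneg_left hBle hcoef
  nlinarith [key, hstep, hB0, hcap, hBsum]

end Summit.AtomisticToContinuum.Crystallization.Theorems.NashClassCertificatesNashNearField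

end
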